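import Summits.RiemannHypothesis.RiemannHypothesis.Theorems.WeilTwoPrimeDeflM77YBase
import Literature.NumberTheory.LFunctions.WeilBlockRowsFast
import HarnessLib

/-!
# Deflated two-prime certificate (weilCertDeflM77Y): the Bessel block claim `Hp = C H Cᵀ` (parity 1), rows 60–64, fast check

`WeilCert.checkHpRowT` (linear traversals) instead of the indexed `checkHpRow` decide.  Pure proof file.
-/

noncomputable section

namespace Summit.RiemannHypothesis.RiemannHypothesis.Theorems.EvenWinsBeyondArch

open Literature.NumberTheory.LFunctions

set_option maxHeartbeats 0 in
/-- Fast kernel check of claim row 60 of `Hp = C H Cᵀ` (parity 1; linear traversals, triangular `C`). [folklore] -/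
theorem checkHpRowT1_60_weilCertDeflM77Y : weilCertDeflM77YBase.checkHpRowT weilCertDeflM77YHpO 1 60 = true := by
  decide +kernel

/-- Claim row 60 of `Hp = C H Cᵀ` (parity 1), from the fast check. [folklore] -/
theorem checkHpRow1_60_weilCertDeflM77Y : weilCertDeflM77YBase.checkHpRow weilCertDeflM77YHpO 1 60 = true :=
  WeilCert.checkHpRow_of_T checkHpRowT1_60_weilCertDeflM77Y

set_option maxHeartbeats 0 in
/-- Fast kernel check of claim row 61 of `Hp = C H Cᵀ` (parity 1; linear traversals, triangular `C`). [folklore] -/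
theorem checkHpRowT1_61_weilCertDeflM77Y : weilCertDeflM77YBase.checkHpRowT weilCertDeflM77YHpO 1 61 = true := by
  decide +kernel

/-- Claim row 61 of `Hp = C H Cᵀ` (parity 1), from the fast check. [folklore] -/
theorem checkHpRow1_61_weilCertDeflM77Y : weilCertDeflM77YBase.checkHpRow weilCertDeflM77YHpO 1 61 = true :=
  WeilCert.checkHpRow_of_T checkHpRowT1_61_weilCertDeflM77Y

set_option maxHeartbeats 0 in
/-- Fast kernel check of claim row 62 of `Hp = C H Cᵀ` (parity 1; linear traversals, triangular `C`). [folklore] -/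
theorem checkHpRowT1_62_weilCertDeflM77Y : weilCertDeflM77YBase.checkHpRowT weilCertDeflM77YHpO 1 62 = true := by
  decide +kernel

/-- Claim row 62 of `Hp = C H Cᵀ` (parity 1), from the fast check. [folklore] -/
theorem checkHpRow1_62_weilCertDeflM77Y : weilCertDeflM77YBase.checkHpRow weilCertDeflM77YHpO 1 62 = true :=
  WeilCert.checkHpRow_of_T checkHpRowT1_62_weilCertDeflM77Y

set_option maxHeartbeats 0 in
/-- Fast kernel check of claim row 63 of `Hp = C H Cᵀ` (parity 1; linear traversals, triangular `C`). [folklore] -/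
theorem checkHpRowT1_63_weilCertDeflM77Y : weilCertDeflM77YBase.checkHpRowT weilCertDeflM77YHpO 1 63 = true := by
  decide +kernel

/-- Claim row 63 of `Hp = C H Cᵀ` (parity 1), from the fast check. [folklore] -/
theorem checkHpRow1_63_weilCertDeflM77Y : weilCertDeflM77YBase.checkHpRow weilCertDeflM77YHpO 1 63 = true :=
  WeilCert.checkHpRow_of_T checkHpRowT1_63_weilCertDeflM77Y

set_option maxHeartbeats 0 in
/-- Fast kernel check of claim row 64 of `Hp = C H Cᵀ` (parity 1; linear traversals, triangular `C`). [folklore] -/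
theorem checkHpRowT1_64_weilCertDeflM77Y : weilCertDeflM77YBase.checkHpRowT weilCertDeflM77YHpO 1 64 = true := by
  decide +kernel

/-- Claim row 64 of `Hp = C H Cᵀ` (parity 1), from the fast check. [folklore] -/
theorem checkHpRow1_64_weilCertDeflM77Y : weilCertDeflM77YBase.checkHpRow weilCertDeflM77YHpO 1 64 = true :=
  WeilCert.checkHpRow_of_T checkHpRowT1_64_weilCertDeflM77Y

end Summit.RiemannHypothesis.RiemannHypothesis.Theorems.EvenWinsBeyondArch
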